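import Summits.MatrixMultiplication.OmegaCensus.STPP222IcosetHSearch
import Mathlib.Tactic.IntervalCases
import Summits.MatrixMultiplication.OmegaCensus.STPP222IcosetClassNoneK6Z11B1

/-!
# ω-census, icoset class negatives: kernel evaluation chunks for `𝔽₂³ × ℤ₁₁`, `K = 6` (part B2: `b₁ = 2`, `c₁ ∈ {6,…,10}`; and the `b₁ = 2` summary)

HONEST FRAMING (pub-omega census; verbatim): lottery ticket; floor = certified bounds/negative ranges.
Census STRUCTURE bookkeeping (Q7), nothing about `ω`.  Pure kernel evaluations of `IcosetH.checkFrom (cyc 11) 6 x y` (the subtree of the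
H-stage search below the level-1 choice `(b₁, c₁) = (x, y)`; engine `STPP222IcosetHSearch.lean`, soundness `STPP222IcosetHSearchSound.lean`),
one `decide +kernel` per `(x, y)` with ≥ 300 search nodes, light ones grouped; the parts are assembled into `IcosetH.check (cyc 11) 6 = true`
and the class negative in `STPP222IcosetClassNoneK6Z11.lean`.  Node counts (seat prototype = ENG2 icoset3; 151 112 in all; ≈ 8 ms/node on the
farm): (2,6): 3884, (2,7): 3884, (2,8): 3973, (2,9): 3996, (2,10): 4762 — this file 20499 nodes.  Seat pub-omega-kernel-l4 (gen 19), 2026-08-27.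
-/

namespace Summit.MatrixMultiplication.OmegaCensus

namespace IcosetH

/-- Kernel evaluation of the `(b₁, c₁) = (2, 6)` subtree (3884 nodes). -/
theorem checkFrom_cyc11_2_6 : checkFrom (cyc 11) 6 2 6 = true := by decide +kernel

/-- Kernel evaluation of the `(b₁, c₁) = (2, 7)` subtree (3884 nodes). -/
theorem checkFrom_cyc11_2_7 : checkFrom (cyc 11) 6 2 7 = true := by decide +kernel

/-- Kernel evaluation of the `(b₁, c₁) = (2, 8)` subtree (3973 nodes). -/
theorem checkFrom_cyc11_2_8 : checkFrom (cyc 11) 6 2 8 = true := by decide +kernel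

/-- Kernel evaluation of the `(b₁, c₁) = (2, 9)` subtree (3996 nodes). -/
theorem checkFrom_cyc11_2_9 : checkFrom (cyc 11) 6 2 9 = true := by decide +kernel

/-- Kernel evaluation of the `(b₁, c₁) = (2, 10)` subtree (4762 nodes). -/
theorem checkFrom_cyc11_2_10 : checkFrom (cyc 11) 6 2 10 = true := by decide +kernel

/-- All level-1 choices `c₁ = y` below `b₁ = 2` are refuted (heavy `y` from the part files, light ones evaluated here). -/
theorem checkFrom_cyc11_2 : ∀ y, y < 11 → checkFrom (cyc 11) 6 2 y = true := by
  intro y hy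
  interval_cases y
  exacts [by decide +kernel, checkFrom_cyc11_2_1, by decide +kernel, checkFrom_cyc11_2_3, checkFrom_cyc11_2_4, checkFrom_cyc11_2_5, checkFrom_cyc11_2_6, checkFrom_cyc11_2_7, checkFrom_cyc11_2_8, checkFrom_cyc11_2_9, checkFrom_cyc11_2_10]

end IcosetH

end Summit.MatrixMultiplication.OmegaCensus
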